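import Literature.GroupTheory.ArithmeticGroups.SL2PrimePowDescentLinear
import HarnessLib

/-!
# The additive core of the descent, torus-free version (all odd `p`)

Companion of `SL2PrimePowDescentLinear`.  There the `T̄`-cocycle constant `z'` of the layer of a central
extension of `SL₂(ℤ/p^e)` was killed by the torus `diag(2, 2⁻¹)`, which needs `p ≥ 5`.  Here we record what
survives for EVERY odd `p` without the torus: the `L̄`-constant equals the `T̄`-constant (`lconst_eq_tconst`,
from `S̄ = T̄⁻¹ L̄ T̄⁻¹`), and the inverse formulas carrying the constant (`t_symm_z`, `l_symm_z`).  The point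
(sequel `SL2PrimePowCentralExtensionOdd`) is that the TWISTED triple `e - z'/2, h - z'/2, f + z'/2` then satisfies
the constant-free `𝔰𝔩₂`-table, so the descent of [Beyl1986]'s theorem runs for `p = 3` as well.
Pure `abel` computations in an additive commutative group.
-/

namespace Literature.GroupTheory.ArithmeticGroups

namespace SL2DescentLinearOdd

variable {V : Type*} [AddCommGroup V]

/-- **The `L̄`-constant equals the `T̄`-constant.** In the additive layer of a central extension of `SL₂(ℤ/p^e)`
with `φt h = h - 2e + z'` and `φl h = h + 2f + z''` (`z', z''` fixed), the exact relations `φs f = -e`, `φs =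
φt⁻¹ φl φt⁻¹` force `z'' = z'`.  (For `p ≥ 5` the torus gives `z' = 0`, file `SL2PrimePowDescentLinear`; this
version needs no torus and serves every odd `p`, in particular `p = 3`.) [cite: Beyl1986, Theorem (M(SL(2,ℤ/m))
= 0 for 4 ∤ m), p-primary part] -/
theorem lconst_eq_tconst (φt φl φs : V ≃+ V) (e h f z' z'' : V) (te : φt e = e) (tf : φt f = h - e + f)
    (th : φt h = h - 2 • e + z') (tz' : φt z' = z') (lf : φl f = f)
    (le : φl e = e - h - f) (lh : φl h = h + 2 • f + z'') (lz' : φl z' = z')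
    (sf : φs f = -e) (hs : ∀ v, φs v = φt.symm (φl (φt.symm v))) : z'' = z' := by
  have tinv_f : φt.symm f = f - h - e + z' := by
    apply φt.injective
    rw [AddEquiv.apply_symm_apply, map_add, map_sub, map_sub, tf, th, te, tz']; abel
  have k1 : φl (φt.symm f) = -e - z'' + z' := by
    rw [tinv_f, map_add, map_sub, map_sub, lf, lh, le, lz']; abel
  have key := hs f
  rw [sf, k1] at key
  have key2 := congr_arg φt key
  simp only [AddEquiv.apply_symm_apply, map_neg, map_add, map_sub, te] at key2
  -- key2 : -e = -e - z'' + z'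
  have : (-e - z'' + z') - (-e) = z' - z'' := by abel
  rw [← key2, sub_self] at this
  exact (sub_eq_zero.mp this.symm).symm

/-- Inverse formulas with the constant: `φt⁻¹ e = e`, `φt⁻¹ h = h + 2e - z'`, `φt⁻¹ f = f - h - e + z'`. [cite:
Beyl1986, Theorem (M(SL(2,ℤ/m)) = 0 for 4 ∤ m), p-primary part] -/
theorem t_symm_z (φt : V ≃+ V) (e h f z' : V) (te : φt e = e) (tf : φt f = h - e + f)
    (th : φt h = h - 2 • e + z') (tz' : φt z' = z') :
    φt.symm e = e ∧ φt.symm h = h + 2 • e - z' ∧ φt.symm f = f - h - e + z' := by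
  refine ⟨?_, ?_, ?_⟩ <;> apply φt.injective <;> rw [AddEquiv.apply_symm_apply]
  · rw [te]
  · rw [map_sub, map_add, map_nsmul, th, te, tz']; abel
  · rw [map_add, map_sub, map_sub, tf, th, te, tz']; abel

/-- Inverse formulas with the constant: `φl⁻¹ f = f`, `φl⁻¹ h = h - 2f - z'`, `φl⁻¹ e = e + h - f - z'`. [cite:
Beyl1986, Theorem (M(SL(2,ℤ/m)) = 0 for 4 ∤ m), p-primary part] -/
theorem l_symm_z (φl : V ≃+ V) (e h f z' : V) (lf : φl f = f) (le : φl e = e - h - f)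
    (lh : φl h = h + 2 • f + z') (lz' : φl z' = z') :
    φl.symm f = f ∧ φl.symm h = h - 2 • f - z' ∧ φl.symm e = e + h - f - z' := by
  refine ⟨?_, ?_, ?_⟩ <;> apply φl.injective <;> rw [AddEquiv.apply_symm_apply]
  · rw [lf]
  · rw [map_sub, map_sub, map_nsmul, lh, lf, lz']; abel
  · rw [map_sub, map_sub, map_add, le, lh, lf, lz']; abel

end SL2DescentLinearOdd

end Literature.GroupTheory.ArithmeticGroups
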